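import Mathlib
import Summits.ValiantsHypothesis.ValiantsHypothesis.Theorems.FifoMatchingNFPolytopeQueueGridFaceDefs
import Literature.Barriers.PneNP.TSPExtensionComplexityFaces
import Literature.Computability.AlgebraicComplexity.GrochowMonotoneCircuitQuasiPolyEF
import Literature.Computability.MetaComplexity.GridTseitinLift
import Literature.Combinatorics.SimpleGraph.SubcubicMinors
import HarnessLib

/-!
# K1 input (B♯): `QueueGridPPHard` from ONE print fact (AFHMS 2019, Theorem 6 at the grid) — Theorems-side port

Port to `Theorems/` (director-valiant R150 (i): c1 g5's hand) of val-idea-7 g7's kernel-checked line workfile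
`Cruxes/NNLinearDegreeCofactorHard/Lines/queue_grid_face_bsharp.lean` (rev 3), over the Theorems-side copies
`QueueGridFace.QGV / qgEdge / patternVec / queueGridPP` of `Theorems/FifoMatchingNFPolytopeQueueGridFaceDefs.lean`
(p613693).  Support item: stmt-ValiantsHypothesis-26254 (`Theses.FifoMatching.NFPolytopeQuasiPolyXC`, K1).  Honesty: K1
open → open (it needs input (A), in flight, AND the print fact below, val-lit desk #253); stmt-23918 / 24468 CLOSED,
untouched; VP ≠ VNP is not moved; nothing here is a lower bound for `NN_n`.

Input (B) of the line (`QueueGridPPHard`: every slack-form EF of the pair-pattern polytope `PP_r` of the `r × r` queue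
grid has more than `2^{(log₂ r + c)^c}` inequalities, eventually) is reduced to the single print fact

  `∃ c > 0, ∀ᶠ t, ∀ R, HasEFOfSize (COR(G_{t,t})) R → 2^{c t} ≤ R`

(Aboulker–Fiorini–Huynh–Macchia–Seif, *Extension complexity of the correlation polytope*, Oper. Res. Lett. 47 (2019)
= arXiv:1806.00541, Theorem 6 p. 5 with `𝒞` = planar graphs, `tw(G_{t,t}) = t`; remark after Theorem 3, p. 4), taken
here as an HYPOTHESIS written out in full (no local `Prop` is declared: the fact is val-lit-p9's to type, as
`Literature/Combinatorics/Optimization/CorrelationPolytopeGridMinor.lean`; the masked-coordinate `corVertex` /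
`corPolytopeGraph` below are verbatim copies of the decls requested there, so the Literature statement will match these
hypotheses by `rfl`).  Glue, all proved (val-idea-7 g7's proofs, unchanged): (g1) the `g × g` grid, `g = ⌊r/2⌋`, is a
SUBGRAPH of the queue grid under `(row, col) ↦ (row + col, col)` (row edges ↦ vertical pairs, column edges ↦ diagonal
pairs); (g2) the coordinate-linear `corMap` sends `patternVec r X` to the COR-vertex of `X ∘ φ` and every grid bit vector
lifts, so `corMap '' PP_r = COR(G_{g,g})` (`LinearMap.image_convexHull`); (g3) `HasEFOfSize.image_linear` (`+ 4r⁴` slack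
columns) and `2^{(log₂ r + c₀)^{c₀}} + 4r⁴ < 2^{c ⌊r/2⌋}` eventually.  Also the grid-MINOR form of the hypothesis (the
G-general typing ruled in R147 (a)) via `IsMinor.refl`.
-/

-- Sub = Summit single-conjunct layout: the duplicated namespace component is mandated by the tree.
set_option linter.dupNamespace false

namespace Summit.ValiantsHypothesis.ValiantsHypothesis.Theorems.FifoMatching.QueueGridFace

open Matrix Literature.Barriers.PneNP Filter Topology
open Literature.Computability.MetaComplexity (gridGraph gridAdj)
open Literature.Combinatorics.SimpleGraph (IsMinor)

noncomputable section

/-! ## Correlation polytope of a graph in masked `V × V` coordinates (copies of the decls requested from val-lit) -/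

/-- the COR-vertex of a bit vector `b`: coordinate `(v,v)` carries `b_v`, an adjacent pair `(u,v)` carries
`b_u b_v` (both orientations), non-adjacent off-diagonal coordinates are masked to `0`.
[cite: AboulkerEtAl2019, §2 proof of Thm 1 (p. 4): "COR(G) is the convex hull of all 0/1-vectors x ∈ ℝ^{V ∪ E}
satisfying x_{uv} = x_u x_v for all uv ∈ E(G)"] -/
def corVertex {V : Type} [DecidableEq V] (G : SimpleGraph V) [DecidableRel G.Adj] (b : V → Bool) :
    V × V → ℝ :=
  fun p => if p.1 = p.2 then (if b p.1 = true then 1 else 0)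
    else if G.Adj p.1 p.2 then (if b p.1 = true ∧ b p.2 = true then 1 else 0) else 0

/-- `COR(G)` in masked `V × V` coordinates. [cite: AboulkerEtAl2019, §2 (p. 4)] -/
def corPolytopeGraph {V : Type} [DecidableEq V] (G : SimpleGraph V) [DecidableRel G.Adj] : Set (V × V → ℝ) :=
  convexHull ℝ (Set.range (corVertex G))

/-! ## (g1) the grid inside the queue grid -/

/-- index bounds for a vertex of the `g × g` grid (val-idea-7 g7; port). -/
theorem grid_index_bounds {g : ℕ} (a : Fin (g * g)) : 0 < g ∧ a.val / g < g ∧ a.val % g < g := by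
  have h0 : 0 < g := Nat.pos_of_ne_zero (fun h => by subst h; exact absurd a.isLt (by simp))
  refine ⟨h0, ?_, Nat.mod_lt _ h0⟩
  exact (Nat.div_lt_iff_lt_mul h0).mpr a.isLt

/-- grid vertex `a` (row `a / g`, column `a % g`) ↦ queue-grid block `(row + col, col)` -/
def phi (r g : ℕ) (hg : 2 * g ≤ r) (a : Fin (g * g)) : QGV r :=
  (⟨a.val / g + a.val % g, by have := grid_index_bounds a; omega⟩,
   ⟨a.val % g, by have := grid_index_bounds a; omega⟩)

/-- the V-type out-neighbour `(row + col + 1, col)` of `phi a` (exists since `row + col ≤ 2g - 2 ≤ r - 2`) -/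
def phiS (r g : ℕ) (hg : 2 * g ≤ r) (a : Fin (g * g)) : QGV r :=
  (⟨a.val / g + a.val % g + 1, by have := grid_index_bounds a; omega⟩,
   ⟨a.val % g, by have := grid_index_bounds a; omega⟩)

/-- glue lemma `phi_injective` (val-idea-7 g7, `Lines/queue_grid_face_bsharp.lean`; port). -/
theorem phi_injective (r g : ℕ) (hg : 2 * g ≤ r) : Function.Injective (phi r g hg) := by
  intro a b h
  simp only [phi, Prod.mk.injEq, Fin.mk.injEq] at h
  apply Fin.ext
  have ha := Nat.div_add_mod a.val g
  have hb := Nat.div_add_mod b.val g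
  have h1 : a.val / g = b.val / g := by omega
  have h2 : a.val % g = b.val % g := h.2
  calc a.val = g * (a.val / g) + a.val % g := ha.symm
    _ = g * (b.val / g) + b.val % g := by rw [h1, h2]
    _ = b.val := hb

/-- glue lemma `qgEdge_iff` (val-idea-7 g7, `Lines/queue_grid_face_bsharp.lean`; port). -/
theorem qgEdge_iff (r : ℕ) (p : QGV r × QGV r) :
    qgEdge r p = true ↔ p.2.1.val = p.1.1.val + 1 ∧ (p.2.2.val = p.1.2.val ∨ p.2.2.val = p.1.2.val + 1) := by
  simp [qgEdge, Bool.and_eq_true, Bool.or_eq_true, beq_iff_eq]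

/-- glue lemma `qgEdge_phi_phiS` (val-idea-7 g7, `Lines/queue_grid_face_bsharp.lean`; port). -/
theorem qgEdge_phi_phiS (r g : ℕ) (hg : 2 * g ≤ r) (a : Fin (g * g)) :
    qgEdge r (phi r g hg a, phiS r g hg a) = true := by
  rw [qgEdge_iff]; exact ⟨rfl, Or.inl rfl⟩

/-- a grid edge is a queue-grid pair in exactly one orientation -/
theorem qgEdge_of_gridAdj (r g : ℕ) (hg : 2 * g ≤ r) (a b : Fin (g * g)) (h : (gridGraph g).Adj a b) :
    (qgEdge r (phi r g hg a, phi r g hg b) = true ∧ qgEdge r (phi r g hg b, phi r g hg a) = false) ∨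
    (qgEdge r (phi r g hg a, phi r g hg b) = false ∧ qgEdge r (phi r g hg b, phi r g hg a) = true) := by
  have key :
      ((b.val / g + b.val % g = a.val / g + a.val % g + 1 ∧ (b.val % g = a.val % g ∨ b.val % g = a.val % g + 1)) ∧
        ¬ (a.val / g + a.val % g = b.val / g + b.val % g + 1 ∧ (a.val % g = b.val % g ∨ a.val % g = b.val % g + 1))) ∨
      (¬ (b.val / g + b.val % g = a.val / g + a.val % g + 1 ∧ (b.val % g = a.val % g ∨ b.val % g = a.val % g + 1)) ∧
        (a.val / g + a.val % g = b.val / g + b.val % g + 1 ∧ (a.val % g = b.val % g ∨ a.val % g = b.val % g + 1))) := by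
    change gridAdj g a b at h
    unfold gridAdj at h
    omega
  have e1 : qgEdge r (phi r g hg a, phi r g hg b) = true ↔
      (b.val / g + b.val % g = a.val / g + a.val % g + 1 ∧ (b.val % g = a.val % g ∨ b.val % g = a.val % g + 1)) :=
    qgEdge_iff r _
  have e2 : qgEdge r (phi r g hg b, phi r g hg a) = true ↔
      (a.val / g + a.val % g = b.val / g + b.val % g + 1 ∧ (a.val % g = b.val % g ∨ a.val % g = b.val % g + 1)) :=
    qgEdge_iff r _
  rcases key with ⟨hA, hB⟩ | ⟨hA, hB⟩
  · left
    refine ⟨e1.mpr hA, ?_⟩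
    simpa using (show ¬ (qgEdge r (phi r g hg b, phi r g hg a) = true) from fun hh => hB (e2.mp hh))
  · right
    refine ⟨?_, e2.mpr hB⟩
    simpa using (show ¬ (qgEdge r (phi r g hg a, phi r g hg b) = true) from fun hh => hA (e1.mp hh))

/-! ## (g2) the linear read-out `PP_r ↠ COR(G_{g,g})` -/

/-- the read-out functional: `b_a := p^{1,0} + p^{1,1}` of the out-pair of `phi a`; `y_{ab} := p^{1,1}` of
whichever orientation of `(phi a, phi b)` is a queue-grid pair (the other coordinate is `0` on `PP_r`); else `0`. -/
def corFun (r g : ℕ) (hg : 2 * g ≤ r) (x : (QGV r × QGV r) × Bool × Bool → ℝ)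
    (p : Fin (g * g) × Fin (g * g)) : ℝ :=
  if p.1 = p.2 then
    x ((phi r g hg p.1, phiS r g hg p.1), (true, false)) + x ((phi r g hg p.1, phiS r g hg p.1), (true, true))
  else if (gridGraph g).Adj p.1 p.2 then
    x ((phi r g hg p.1, phi r g hg p.2), (true, true)) + x ((phi r g hg p.2, phi r g hg p.1), (true, true))
  else 0

/-- `corFun` as a linear map -/
def corMap (r g : ℕ) (hg : 2 * g ≤ r) :
    ((QGV r × QGV r) × Bool × Bool → ℝ) →ₗ[ℝ] (Fin (g * g) × Fin (g * g) → ℝ) where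
  toFun := corFun r g hg
  map_add' x y := by
    funext p
    simp only [corFun, Pi.add_apply]
    split_ifs <;> ring
  map_smul' a x := by
    funext p
    simp only [corFun, Pi.smul_apply, smul_eq_mul, RingHom.id_apply]
    split_ifs <;> ring

/-- glue lemma `corMap_apply` (val-idea-7 g7, `Lines/queue_grid_face_bsharp.lean`; port). -/
theorem corMap_apply (r g : ℕ) (hg : 2 * g ≤ r) (x : (QGV r × QGV r) × Bool × Bool → ℝ)
    (p : Fin (g * g) × Fin (g * g)) : corMap r g hg x p = corFun r g hg x p := rfl

/-- the read-out of a pattern vector is the COR-vertex of the restricted bit vector -/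
theorem corMap_patternVec (r g : ℕ) (hg : 2 * g ≤ r) (X : QGV r → Bool) :
    corMap r g hg (patternVec r X) = corVertex (gridGraph g) (X ∘ phi r g hg) := by
  funext p
  obtain ⟨a, b⟩ := p
  rw [corMap_apply]
  by_cases hab : a = b
  · subst hab
    have hq := qgEdge_phi_phiS r g hg a
    cases hXa : X (phi r g hg a) <;> cases hXs : X (phiS r g hg a) <;>
      simp [corFun, corVertex, patternVec, hq, hXa, hXs]
  · by_cases hadj : (gridGraph g).Adj a b
    · rcases qgEdge_of_gridAdj r g hg a b hadj with ⟨h1, h2⟩ | ⟨h1, h2⟩ <;>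
        cases hXa : X (phi r g hg a) <;> cases hXb : X (phi r g hg b) <;>
          simp [corFun, corVertex, patternVec, hab, hadj, h1, h2, hXa, hXb]
    · simp [corFun, corVertex, hab, hadj]

/-- every bit vector of the grid lifts along `phi` -/
def liftBits (r g : ℕ) (hg : 2 * g ≤ r) (b : Fin (g * g) → Bool) : QGV r → Bool :=
  fun v => if h : ∃ a, phi r g hg a = v then b h.choose else false

/-- glue lemma `liftBits_phi` (val-idea-7 g7, `Lines/queue_grid_face_bsharp.lean`; port). -/
theorem liftBits_phi (r g : ℕ) (hg : 2 * g ≤ r) (b : Fin (g * g) → Bool) (a : Fin (g * g)) :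
    liftBits r g hg b (phi r g hg a) = b a := by
  have h : ∃ a', phi r g hg a' = phi r g hg a := ⟨a, rfl⟩
  show (if h : ∃ a', phi r g hg a' = phi r g hg a then b h.choose else false) = b a
  rw [dif_pos h]
  exact congrArg b (phi_injective r g hg h.choose_spec)

/-- glue lemma `range_corMap_patternVec` (val-idea-7 g7, `Lines/queue_grid_face_bsharp.lean`; port). -/
theorem range_corMap_patternVec (r g : ℕ) (hg : 2 * g ≤ r) :
    Set.range (fun X => corMap r g hg (patternVec r X)) = Set.range (corVertex (gridGraph g)) := by
  ext y
  constructor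
  · rintro ⟨X, rfl⟩
    exact ⟨X ∘ phi r g hg, (corMap_patternVec r g hg X).symm⟩
  · rintro ⟨b, rfl⟩
    refine ⟨liftBits r g hg b, ?_⟩
    show corMap r g hg (patternVec r (liftBits r g hg b)) = corVertex (gridGraph g) b
    rw [corMap_patternVec]
    congr 1
    funext a
    exact liftBits_phi r g hg b a

/-- **(g2)** `COR(G_{g,g})` is a coordinate-linear image of the pair-pattern polytope `PP_r`, `2g ≤ r`. -/
theorem corMap_image_queueGridPP (r g : ℕ) (hg : 2 * g ≤ r) :
    corMap r g hg '' queueGridPP r = corPolytopeGraph (gridGraph g) := by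
  unfold queueGridPP corPolytopeGraph
  rw [LinearMap.image_convexHull, ← Set.range_comp,
    show Set.range (⇑(corMap r g hg) ∘ patternVec r) = Set.range (corVertex (gridGraph g)) from
      range_corMap_patternVec r g hg]

/-- glue lemma `queueGridPP_nonneg` (val-idea-7 g7, `Lines/queue_grid_face_bsharp.lean`; port). -/
theorem queueGridPP_nonneg (r : ℕ) (x : (QGV r × QGV r) × Bool × Bool → ℝ) (hx : x ∈ queueGridPP r)
    (i : (QGV r × QGV r) × Bool × Bool) : 0 ≤ x i := by
  have hsub : Set.range (patternVec r) ⊆ Set.univ.pi (fun _ => Set.Ici (0 : ℝ)) := by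
    rintro _ ⟨X, rfl⟩
    simp only [Set.mem_univ_pi, Set.mem_Ici]
    intro j
    unfold patternVec
    split_ifs <;> norm_num
  have hx' := convexHull_min hsub (convex_pi fun _ _ => convex_Ici (0 : ℝ)) hx
  exact Set.mem_univ_pi.mp hx' i

/-- **(g2)+(g3)** an EF of `PP_r` with `t` inequalities gives one of `COR(G_{g,g})` with `4r⁴ + t`. -/
theorem hasEFOfSize_cor_of_pp (r g : ℕ) (hg : 2 * g ≤ r) (t : ℕ) (h : HasEFOfSize (queueGridPP r) t) :
    HasEFOfSize (corPolytopeGraph (gridGraph g)) (Fintype.card ((QGV r × QGV r) × Bool × Bool) + t) := by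
  rw [← corMap_image_queueGridPP r g hg]
  exact h.image_linear (queueGridPP_nonneg r) (corMap r g hg)

/-- glue lemma `card_patternIndex` (val-idea-7 g7, `Lines/queue_grid_face_bsharp.lean`; port). -/
theorem card_patternIndex (r : ℕ) : Fintype.card ((QGV r × QGV r) × Bool × Bool) = 4 * r ^ 4 := by
  simp only [QGV, Fintype.card_prod, Fintype.card_fin, Fintype.card_bool]
  ring

/-! ## (g3) growth: quasi-polynomial + polynomial < exponential in `⌊r/2⌋`, eventually -/

/-- polynomial versus exponential, the one analytic input (`n^k / 2^n → 0`) -/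
theorem poly_le_exp_eventually (c₀ : ℕ) {c : ℝ} (hc : 0 < c) :
    ∃ K : ℕ, 1 ≤ K ∧ ∀ k ≥ K, (((k + c₀) ^ c₀ + 4 * k + 7 : ℕ) : ℝ) ≤ c * 2 ^ (k - 1) := by
  have h1 : Tendsto (fun k : ℕ => (((k + c₀ : ℕ) : ℝ)) ^ c₀ / 2 ^ (k + c₀)) atTop (𝓝 0) :=
    (tendsto_pow_const_div_const_pow_of_one_lt c₀ (one_lt_two : (1 : ℝ) < 2)).comp (tendsto_add_atTop_nat c₀)
  have h2 : Tendsto (fun k : ℕ => ((k : ℕ) : ℝ) ^ 1 / 2 ^ k) atTop (𝓝 0) :=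
    tendsto_pow_const_div_const_pow_of_one_lt 1 (one_lt_two : (1 : ℝ) < 2)
  have hε₁ : (0 : ℝ) < c / 4 / 2 ^ c₀ := by positivity
  have hε₂ : (0 : ℝ) < c / 4 / 11 := by positivity
  have e1 := h1.eventually (gt_mem_nhds hε₁)
  have e2 := h2.eventually (gt_mem_nhds hε₂)
  obtain ⟨K, hK⟩ := Filter.eventually_atTop.mp (e1.and e2)
  refine ⟨max K 1, le_max_right _ _, fun k hk => ?_⟩
  have hkK : K ≤ k := le_trans (le_max_left _ _) hk
  have hk1 : 1 ≤ k := le_trans (le_max_right _ _) hk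
  obtain ⟨hA, hB⟩ := hK k hkK
  have h2pos : (0 : ℝ) < 2 ^ (k + c₀) := by positivity
  have h2pos' : (0 : ℝ) < 2 ^ k := by positivity
  have hA1 : (((k + c₀ : ℕ) : ℝ)) ^ c₀ / 2 ^ (k + c₀) < c / 4 / 2 ^ c₀ := hA
  have hB1 : ((k : ℕ) : ℝ) ^ 1 / 2 ^ k < c / 4 / 11 := hB
  have hA' : (((k + c₀ : ℕ) : ℝ)) ^ c₀ < c / 4 / 2 ^ c₀ * 2 ^ (k + c₀) := (div_lt_iff₀ h2pos).mp hA1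
  have hB' : ((k : ℕ) : ℝ) ^ 1 < c / 4 / 11 * 2 ^ k := (div_lt_iff₀ h2pos').mp hB1
  have hsplit : (2 : ℝ) ^ (k + c₀) = 2 ^ k * 2 ^ c₀ := pow_add 2 k c₀
  have hc₀pos : (0 : ℝ) < 2 ^ c₀ := by positivity
  have hA'' : (((k + c₀ : ℕ) : ℝ)) ^ c₀ < c / 4 * 2 ^ k := by
    calc (((k + c₀ : ℕ) : ℝ)) ^ c₀ < c / 4 / 2 ^ c₀ * 2 ^ (k + c₀) := hA'
      _ = c / 4 * 2 ^ k := by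
          rw [hsplit, mul_comm ((2 : ℝ) ^ k) (2 ^ c₀), ← mul_assoc, div_mul_cancel₀ _ hc₀pos.ne']
  have hB'' : ((k : ℕ) : ℝ) < c / 4 / 11 * 2 ^ k := by rw [pow_one] at hB'; exact hB'
  obtain ⟨j, rfl⟩ : ∃ j, k = j + 1 := ⟨k - 1, by omega⟩
  simp only [Nat.add_sub_cancel]
  have hpow : (2 : ℝ) ^ (j + 1) = 2 * 2 ^ j := by rw [pow_succ]; ring
  rw [hpow] at hA'' hB''
  have hcast : (((j + 1 + c₀) ^ c₀ + 4 * (j + 1) + 7 : ℕ) : ℝ)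
      = (((j + 1 + c₀ : ℕ) : ℝ)) ^ c₀ + 4 * ((j + 1 : ℕ) : ℝ) + 7 := by push_cast; ring
  rw [hcast]
  have hj1 : (1 : ℝ) ≤ ((j + 1 : ℕ) : ℝ) := by exact_mod_cast hk1
  linarith [hA'', hB'', hj1, h2pos']

/-- the growth estimate the glue needs: `2^{(log₂ r + c₀)^{c₀}} + 4 r⁴ < 2^{c ⌊r/2⌋}` for `r ≥ r₀(c₀, c)` -/
theorem growth_eventually (c₀ : ℕ) {c : ℝ} (hc : 0 < c) :
    ∃ r₀ : ℕ, 2 ≤ r₀ ∧ ∀ r ≥ r₀,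
      (2 : ℝ) ^ ((Nat.log 2 r + c₀) ^ c₀) + 4 * (r : ℝ) ^ 4 < (2 : ℝ) ^ (c * ((r / 2 : ℕ) : ℝ)) := by
  obtain ⟨K, hK1, hK⟩ := poly_le_exp_eventually c₀ hc
  refine ⟨2 ^ K, ?_, fun r hr => ?_⟩
  · calc 2 = 2 ^ 1 := by norm_num
      _ ≤ 2 ^ K := Nat.pow_le_pow_right (by norm_num) hK1
  set k := Nat.log 2 r with hk
  have hr0 : r ≠ 0 := by
    have : 0 < 2 ^ K := Nat.two_pow_pos K
    omega
  have hlow : 2 ^ k ≤ r := Nat.pow_log_le_self 2 hr0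
  have hup : r < 2 ^ (k + 1) := Nat.lt_pow_succ_log_self (by norm_num) r
  have hKk : K ≤ k := by
    by_contra hlt
    push Not at hlt
    have : 2 ^ (k + 1) ≤ 2 ^ K := Nat.pow_le_pow_right (by norm_num) hlt
    omega
  have hk1 : 1 ≤ k := le_trans hK1 hKk
  -- g = ⌊r/2⌋ ≥ 2^(k-1)
  have hg : 2 ^ (k - 1) ≤ r / 2 := by
    have h2 : 2 ^ k = 2 * 2 ^ (k - 1) := by
      obtain ⟨j, hj⟩ : ∃ j, k = j + 1 := ⟨k - 1, by omega⟩
      rw [hj, pow_succ, Nat.add_sub_cancel]; ring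
    omega
  have hpoly := hK k hKk
  -- natural-number packaging of the two summands below one power of two
  set q := (k + c₀) ^ c₀ with hq
  set E := q + 4 * k + 6 with hE
  have hN : 2 ^ q + 2 ^ (4 * k + 6) ≤ 2 ^ (E + 1) := by
    have h1 : 2 ^ q ≤ 2 ^ E := Nat.pow_le_pow_right (by norm_num) (by omega)
    have h2 : 2 ^ (4 * k + 6) ≤ 2 ^ E := Nat.pow_le_pow_right (by norm_num) (by omega)
    have h3 : 2 ^ (E + 1) = 2 ^ E + 2 ^ E := by rw [pow_succ]; ring
    omega
  have hr4nat : 4 * r ^ 4 < 2 ^ (4 * k + 6) := by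
    have h4 : r ^ 4 < (2 ^ (k + 1)) ^ 4 := Nat.pow_lt_pow_left hup (by norm_num)
    have h5 : (2 ^ (k + 1)) ^ 4 = 2 ^ (4 * k + 4) := by rw [← pow_mul]; ring_nf
    have h6 : 2 ^ (4 * k + 6) = 4 * 2 ^ (4 * k + 4) := by
      rw [show 4 * k + 6 = (4 * k + 4) + 2 by ring, pow_add]; ring
    rw [h5] at h4
    rw [h6]
    omega
  have hr4 : 4 * (r : ℝ) ^ 4 < (2 : ℝ) ^ (4 * k + 6) := by exact_mod_cast hr4nat
  have hN' : (2 : ℝ) ^ q + (2 : ℝ) ^ (4 * k + 6) ≤ (2 : ℝ) ^ (E + 1) := by exact_mod_cast hN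
  -- the exponent comparison `E + 1 ≤ c * g`
  have hexp : ((E + 1 : ℕ) : ℝ) ≤ c * ((r / 2 : ℕ) : ℝ) := by
    have hE0 : E + 1 = (k + c₀) ^ c₀ + 4 * k + 7 := by rw [hE, hq]
    have hE' : ((E + 1 : ℕ) : ℝ) = (((k + c₀) ^ c₀ + 4 * k + 7 : ℕ) : ℝ) := congrArg Nat.cast hE0
    rw [hE']
    have hg' : ((2 : ℝ) ^ (k - 1)) ≤ ((r / 2 : ℕ) : ℝ) := by exact_mod_cast hg
    calc (((k + c₀) ^ c₀ + 4 * k + 7 : ℕ) : ℝ) ≤ c * 2 ^ (k - 1) := hpoly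
      _ ≤ c * ((r / 2 : ℕ) : ℝ) := by exact mul_le_mul_of_nonneg_left hg' hc.le
  have hlast : (2 : ℝ) ^ (E + 1) ≤ (2 : ℝ) ^ (c * ((r / 2 : ℕ) : ℝ)) := by
    have := Real.rpow_le_rpow_of_exponent_le (one_le_two : (1 : ℝ) ≤ 2) hexp
    rwa [Real.rpow_natCast] at this
  calc (2 : ℝ) ^ ((Nat.log 2 r + c₀) ^ c₀) + 4 * (r : ℝ) ^ 4
      = (2 : ℝ) ^ q + 4 * (r : ℝ) ^ 4 := by rw [hq]
    _ < (2 : ℝ) ^ q + (2 : ℝ) ^ (4 * k + 6) := by linarith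
    _ ≤ (2 : ℝ) ^ (E + 1) := hN'
    _ ≤ (2 : ℝ) ^ (c * ((r / 2 : ℕ) : ℝ)) := hlast

/-! ## B♯ ⇒ B -/

/-- **`QueueGridPPHard` (body verbatim) from the AFHMS 2019 grid bound**, the bound taken as a hypothesis written in
full (`∃ c > 0, ∀ᶠ t, ∀ R, HasEFOfSize (COR(G_{t,t})) R → 2^{c t} ≤ R`).  With input (A) of the line this makes K1
(`Theses.FifoMatching.NFPolytopeQuasiPolyXC`) a consequence of (A) + one print fact. [val-idea-7 g7; port] -/
theorem queueGridPPHard_of_corGridBound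
    (hB : ∃ c : ℝ, 0 < c ∧ ∀ᶠ t : ℕ in atTop, ∀ R : ℕ,
      HasEFOfSize (corPolytopeGraph (gridGraph t)) R → (2 : ℝ) ^ (c * t) ≤ R) :
    ∀ c : ℕ, ∃ r₀ : ℕ, ∀ r ≥ r₀, ∀ t : ℕ, HasEFOfSize (queueGridPP r) t → 2 ^ ((Nat.log 2 r + c) ^ c) < t := by
  intro c₀
  obtain ⟨c, hc, hev⟩ := hB
  obtain ⟨T₀, hT₀⟩ := Filter.eventually_atTop.mp hev
  obtain ⟨r₁, hr₁2, hgrowth⟩ := growth_eventually c₀ hc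
  refine ⟨max r₁ (2 * T₀), fun r hr t ht => ?_⟩
  have hr₁ : r₁ ≤ r := le_trans (le_max_left _ _) hr
  have hrT : 2 * T₀ ≤ r := le_trans (le_max_right _ _) hr
  set g := r / 2 with hgdef
  have hg2 : 2 * g ≤ r := by omega
  have hgT : T₀ ≤ g := by omega
  -- transport the EF to COR(G_{g,g}) and apply the fact
  have hcor := hasEFOfSize_cor_of_pp r g hg2 t ht
  rw [card_patternIndex] at hcor
  have hfact := hT₀ g hgT (4 * r ^ 4 + t) hcor
  have hgr := hgrowth r hr₁
  -- compare
  have hcast : (((4 * r ^ 4 + t : ℕ)) : ℝ) = 4 * (r : ℝ) ^ 4 + (t : ℝ) := by push_cast; ring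
  rw [hcast] at hfact
  have hreal : ((2 ^ ((Nat.log 2 r + c₀) ^ c₀) : ℕ) : ℝ) < (t : ℝ) := by
    push_cast
    linarith
  exact_mod_cast hreal

/-- **The same from the grid-MINOR form** of the AFHMS bound (the G-general typing of R147 (a): every graph with a
`G_{h,h}` minor has `xc(COR(G)) ≥ 2^{c h}`; `log n` term of the printed remark dropped), via `IsMinor.refl`.
[val-idea-7 g7; port] -/
theorem queueGridPPHard_of_corGridMinorBound
    (hM : ∃ c : ℝ, 0 < c ∧ ∀ h : ℕ, 1 ≤ h →
      ∀ (β : Type) [Fintype β] [DecidableEq β] (G : SimpleGraph β) [DecidableRel G.Adj],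
        IsMinor (gridGraph h) G → ∀ R : ℕ, HasEFOfSize (corPolytopeGraph G) R → (2 : ℝ) ^ (c * h) ≤ R) :
    ∀ c : ℕ, ∃ r₀ : ℕ, ∀ r ≥ r₀, ∀ t : ℕ, HasEFOfSize (queueGridPP r) t → 2 ^ ((Nat.log 2 r + c) ^ c) < t := by
  apply queueGridPPHard_of_corGridBound
  obtain ⟨c, hc, h⟩ := hM
  exact ⟨c, hc, Filter.eventually_atTop.mpr ⟨1, fun t ht R hR => h t ht _ (gridGraph t) (IsMinor.refl _) R hR⟩⟩

end

end Summit.ValiantsHypothesis.ValiantsHypothesis.Theorems.FifoMatching.QueueGridFace
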